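/-
COR-CM (cell pub-hodgecm2, stage 2 of the Hodge ladder) — count-neutral KERNEL CENSUS → TREE TRANSPORT of the faithful full EVEN
slice, NUMERIC INSTANCES II (seat prover-pub-hodgecm2-b23-g37-0, binder prover b23, gen 37; lane EVEN-SLICE, blanket
`Census/EvenSlice*` HOME/INBOX.md l.8803; sequel of `Census/EvenSliceFaceTransportCounts.lean` and `Census/EvenSliceOrbitCountB.lean`).
Theorems only: `exists_faceSet_evenSliceSquares_aut` with `card_orbitsA_zmod_two_four` / `card_orbitsA_zmod_two_six` substituted BY
NAME; no definition, no named fact, nothing asserted; `Interfaces.lean` (C1), every E term, B01 and `Transposition/*` are untouched.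
HONEST FRAMING (COORDINATOR RULING — HODGE FRAMING CORRECTION, 2026-08-21T11:55:35Z): `HC_CM` is NOT proved, here or anywhere in
the tree.  Each theorem says, for ONE Galois CM field `K` of the stated Galois type: a set of at most `N` rank-four faces of `K` EXISTS
whose face periods on the universe of record would imply the Hodge conjecture for the abelian varieties generated by `K`; no period is
produced and nothing is discharged for any field.
T5 (coordinator ruling 15:33:56Z (3)): binder sets = those of `Census/EvenSliceFaceTransport.lean` (`Aut`-datum, face periods = crux
instances with no `¬` theorem in the tree) — no contradiction derivable; checker: self (prover-pub-hodgecm2-b23-g37-0), 2026-08-22.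
-/
import Summits.HodgeConjecture.CorCM.Census.EvenSliceFaceTransport
import Summits.HodgeConjecture.CorCM.Census.EvenSliceOrbitCountB
import HarnessLib

/-!
# The faithful full even slice, transported — the numbers II: `22` faces for `(ℤ/2)² × ℤ/4`, `188` for `(ℤ/2)² × ℤ/6`

| `A` | Galois group of `K` | fields | `#OrbitsA A` | faces `≤` |
|---|---|---|---|---|
| `ℤ/2 × ℤ/4` | `(ℤ/2)² × ℤ/4`, `c ∉ Gal²` | `ℚ(ζ₄₀)`, `ℚ(ζ₄₈)`, `ℚ(ζ₆₀)` | `23` | `22` |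
| `ℤ/2 × ℤ/6` | `(ℤ/2)² × ℤ/6` | `ℚ(ζ₅₆)`, `ℚ(ζ₇₂)`, `ℚ(ζ₈₄)` | `189` | `188` |

The second row is lit-andre-3's degree-24 census row `(ℤ/2)² × ℤ/6: 188`, now certificate-free; by seat b09's parity floor
(`CorCM/FaceParityFloor.lean`) and the seat's `Census/EvenSliceLaw.lean` neither number can be lowered.  (FRAMING: existence of the
face set + a conditional; `HC_CM` is not proved, no period is produced.)

References: [cite: Pohlmann1968, Thm. 1]; [cite: Milne1999LefschetzClasses, Thm. 3.2 and Cor. 4.5];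
[cite: Shimura1998, §6.2 Theorem 3 and §6.1 Corollary of Theorem 2 (pp. 41–43)]; [cite: MumfordAV1970, §19 Thm. 1 and p. 169].
-/

noncomputable section

open CategoryTheory NumberField NumberField.ComplexEmbedding
open Literature.AlgebraicGeometry Literature.AlgebraicGeometry.Motives Literature.AlgebraicGeometry.HodgeTheory
open Literature.AlgebraicGeometry.ComplexMultiplication Literature.AlgebraicGeometry.Milne1999
open Literature.NumberTheory.Automorphic
open Literature.NumberTheory.Automorphic.PicardCM
open Summit.HodgeConjecture.CorCM.Domination

namespace Summit.HodgeConjecture.CorCM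

open Summit.HodgeConjecture.CorCM.Census.OddDegreeParityLaw (OrbitsA)
open Summit.HodgeConjecture.CorCM.Census.EvenSliceOrbitCount

/-! ## The numeric instances II -/

section Counts

/-- **`(ℤ/2)² × ℤ/4` with `c ∉ Gal²` (`ℚ(ζ₄₀)`, `ℚ(ζ₄₈)`, `ℚ(ζ₆₀)`): at most `22` faces** whose periods on the universe of record imply the Hodge conjecture for every complex abelian variety dominated by a
finite product of abelian varieties realising CM types of CM fields embeddable in `K` (`card_orbitsA_zmod_two_four`).  (FRAMING: existence of the face
set + a conditional; `HC_CM` is not proved, no period is produced.)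
[cite: Shimura1998, §6.2 Theorem 3 and §6.1 Corollary of Theorem 2 (pp. 41–43)] [cite: Pohlmann1968, Thm. 1]
[cite: Milne1999LefschetzClasses, Thm. 3.2 and Cor. 4.5] [cite: MumfordAV1970, §19 Thm. 1 and p. 169] -/
theorem exists_faceSet_evenSlice_zmod_two_four (K : CMField) [hGal : IsGalois ℚ K] (σ₀ : (K : Type) →+* ℂ)
    (ε : ((K : Type) ≃ₐ[ℚ] (K : Type)) ≃ ZMod 2 × (ZMod 2 × ZMod 4))
    (hε : ∀ x y : ((K : Type) ≃ₐ[ℚ] (K : Type)), ε (x * y) = ε x + ε y)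
    {c : ((K : Type) ≃ₐ[ℚ] (K : Type))} (hcσ : σ₀.comp (c : (K : Type) →+* (K : Type)) = conjugate σ₀) (hεc : ε c = (1, 0)) :
    ∃ 𝒮 : Finset (Face K), 𝒮.card ≤ 22 ∧
      ((∀ f ∈ 𝒮, ∃ ι₁ : K →+* ℂ, f.Admissible ι₁ ∧ ∃ (V : HermSpace3 K ι₁) (σ : K →+* ℂ),
        (Model.picardCMUniverse exists_isReal_hodgeModel_holds hodgePQ_independent_of_hodgeModel_holds
          BallQuotient.ballQuotientUniformised_holds cmAbelianVarietyRealised_holds).PeriodNV ι₁ V K f.psi σ) →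
      ∀ {P B : AbelianVariety ℂ}, AbelianVariety.IsProductOf (fun B : AbelianVariety ℂ =>
        ∃ (E : Type) (_ : Field E) (_ : NumberField E) (_ : IsCMField E) (_ : E →+* (K : Type)) (Φ : CMType E)
          (ι : 𝓞 E →+* End B) (θ : E →+* Module.End ℂ (complexBetti B.X 1)),
          IsCMTypeRealisation Φ B ι θ) P →
      AVDominatedBy B P → HodgeConjectureFor B.dim B.X) := by
  have hA : Even (Fintype.card (ZMod 2 × ZMod 4)) := by rw [Fintype.card_prod, ZMod.card, ZMod.card]; decide
  have h4 : 4 ≤ Fintype.card (ZMod 2 × ZMod 4) := by rw [Fintype.card_prod, ZMod.card, ZMod.card]; decide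
  obtain ⟨𝒮, hcard, h⟩ := exists_faceSet_evenSliceSquares_aut K hA h4 σ₀ ε hε hcσ hεc
  refine ⟨𝒮, ?_, h⟩
  rw [← Nat.card_eq_fintype_card, card_orbitsA_zmod_two_four] at hcard
  omega

/-- **`(ℤ/2)² × ℤ/6` (`ℚ(ζ₅₆)`, `ℚ(ζ₇₂)`, `ℚ(ζ₈₄)`): at most `188` faces (lit-andre-3's degree-24 row)** whose periods on the universe of record imply the Hodge conjecture for every complex abelian variety dominated by a
finite product of abelian varieties realising CM types of CM fields embeddable in `K` (`card_orbitsA_zmod_two_six`).  (FRAMING: existence of the face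
set + a conditional; `HC_CM` is not proved, no period is produced.)
[cite: Shimura1998, §6.2 Theorem 3 and §6.1 Corollary of Theorem 2 (pp. 41–43)] [cite: Pohlmann1968, Thm. 1]
[cite: Milne1999LefschetzClasses, Thm. 3.2 and Cor. 4.5] [cite: MumfordAV1970, §19 Thm. 1 and p. 169] -/
theorem exists_faceSet_evenSlice_zmod_two_six (K : CMField) [hGal : IsGalois ℚ K] (σ₀ : (K : Type) →+* ℂ)
    (ε : ((K : Type) ≃ₐ[ℚ] (K : Type)) ≃ ZMod 2 × (ZMod 2 × ZMod 6))
    (hε : ∀ x y : ((K : Type) ≃ₐ[ℚ] (K : Type)), ε (x * y) = ε x + ε y)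
    {c : ((K : Type) ≃ₐ[ℚ] (K : Type))} (hcσ : σ₀.comp (c : (K : Type) →+* (K : Type)) = conjugate σ₀) (hεc : ε c = (1, 0)) :
    ∃ 𝒮 : Finset (Face K), 𝒮.card ≤ 188 ∧
      ((∀ f ∈ 𝒮, ∃ ι₁ : K →+* ℂ, f.Admissible ι₁ ∧ ∃ (V : HermSpace3 K ι₁) (σ : K →+* ℂ),
        (Model.picardCMUniverse exists_isReal_hodgeModel_holds hodgePQ_independent_of_hodgeModel_holds
          BallQuotient.ballQuotientUniformised_holds cmAbelianVarietyRealised_holds).PeriodNV ι₁ V K f.psi σ) →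
      ∀ {P B : AbelianVariety ℂ}, AbelianVariety.IsProductOf (fun B : AbelianVariety ℂ =>
        ∃ (E : Type) (_ : Field E) (_ : NumberField E) (_ : IsCMField E) (_ : E →+* (K : Type)) (Φ : CMType E)
          (ι : 𝓞 E →+* End B) (θ : E →+* Module.End ℂ (complexBetti B.X 1)),
          IsCMTypeRealisation Φ B ι θ) P →
      AVDominatedBy B P → HodgeConjectureFor B.dim B.X) := by
  have hA : Even (Fintype.card (ZMod 2 × ZMod 6)) := by rw [Fintype.card_prod, ZMod.card, ZMod.card]; decide
  have h4 : 4 ≤ Fintype.card (ZMod 2 × ZMod 6) := by rw [Fintype.card_prod, ZMod.card, ZMod.card]; decide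
  obtain ⟨𝒮, hcard, h⟩ := exists_faceSet_evenSliceSquares_aut K hA h4 σ₀ ε hε hcσ hεc
  refine ⟨𝒮, ?_, h⟩
  rw [← Nat.card_eq_fintype_card, card_orbitsA_zmod_two_six] at hcard
  omega

end Counts

end Summit.HodgeConjecture.CorCM

end
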